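import Summits.BirchSwinnertonDyer.Rank1Residual.X10.CoreTheoremAOddPrimeOfFacts
import Literature.NumberTheory.GaloisCohomology.PoitouTateNumberField
import Literature.NumberTheory.EllipticCurves.Kato2004.IwasawaH1ReductionRoots
import Literature.NumberTheory.EllipticCurves.PadicSigmaThreeExistence
import Literature.NumberTheory.EllipticCurves.Greenberg1999.RankZeroEulerCharacteristicOddPrimeProofs
import Literature.NumberTheory.EllipticCurves.SkinnerUrban2014.PAdicUnitPeriodRatioProofs
import HarnessLib

/-!
# N2 (class X10b, `p = 3`) — MAXIMAL DISCHARGE: the typed core `CoreTheoremAOddPrime` modulo Kato §13.8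
# ALONE, the node `KatoMuTransferThree` modulo Kato's Thm. 12.6 package ∧ §13.8, and the A5 leaf with
# Poitou–Tate, the Mazur–Tate `σ` at `3` and Greenberg's Thm. 4.1 SUPPLIED BY TREE THEOREMS (cell
# `b2b-bsdres`, unit `b2b-bsdres-x10` = N2 class lead, GEN 40; theorems only; nothing asserted, nothing
# booked)

HONEST FRAMING (run/shared/lean/b2b/bsd-rank1-residual/, verbatim in every file): the goal of the
cell is to DELETE the COMBINATION-SHAPED residual classes of the Birch–Swinnerton-Dyer formula for
analytic-rank `≤ 1` curves over `ℚ` using PUBLISHED theorems only, and to TYPE the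
CONSTRUCTION-SHAPED remainder; this is not "finishing BSD".  Class X10b (= N2) is
CONSTRUCTION-SHAPED / NEEDS X_A3 and stays so: this file only REMOVES hypotheses of GEN 39's
`X10/CoreTheoremAOddPrimeOfFacts` that the tree now proves; it books nothing, it moves no census word
and no mark.  PARTITION (D-0054): X10b∧¬Surj (A5) × p = 3 and X9 (A4) × p ∈ {5, 7} (the core is uniform
in the odd prime) — types-the-object-of; closes NONE.

## What changed since GEN 39 (all three are tree theorems, none by this unit)

* F3 = Poitou–Tate over `ℚ`: `GaloisCohomology.poitouTate_sum_localTatePairing_eq_zero_holds` (cell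
  `bsd-cn100`, p475389, 2026-08-26T23:39Z; Tate's reciprocity law for every number field and level, Milne
  ADT I Thm. 4.10 (b)) — the aside item 19845 of route `SmallImageMuTransfer` is closed by it
  (`Theorems/SmallImageMuTransferPoitouTateSumLocalPairingsRat`, this unit, p477977);
* the Mazur–Tate `σ`-pair EXISTS at `p = 3`: `mazur_tate_sigma_exists_odd_holds` (sub-cell x1a,
  `Literature/…/PadicSigmaThreeExistence`; Blakestad–Grant for the universal ordinary `a₂`-curve over
  `R̂₃`) — discharges the A5 binder `hMT`;
* Greenberg 1999 Thm. 4.1 at every odd prime from Schneider 1985 and the `σ`-fact: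
  `greenberg_charValue_rankZero_of_Schneider1985_odd hS hMT` — discharges the A5 binder `hGr` given the
  binder `hS` the leaf carries anyway;
* and F2 = Kato §13.8 is REDUCED by k6-g4 g2 (p477776) to the weak Lemma 8.5 (2)
  (`Kato2004.mem_pSmul_of_red_eq_zero_of_integral_of_smul_mem`), whose proof is in flight (lur-a g2,
  k6-g3 g2): the `_of_integral` variants below take F2 in exactly that reduced form.

## Declarations (theorems only)

* **`coreTheoremAOddPrime_of_red (hred) : CoreTheoremAOddPrime`** — N2's typed core from Kato §13.8 ALONE;
  `coreTheoremAOddPrime_of_integral_of_smul_mem (hint)` — the same from the weak Lemma 8.5 (2);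
* `coreTheoremAOnClassX10b_of_red` — the registered `p = 3` shape;
* **`katoMuTransferThree_of_fine_red (hfine) (hred) : KatoMuTransferThree`**, `mu_eq_zero_of_fine_red` —
  N2's `μ`-transfer node and the uniform odd-prime `μ = 0` statement from F1 ∧ F2;
  `katoMuTransferThree_of_fine_of_integral (hfine) (hint)`;
* `mazurMainConjectureOnClassX10b_of_fine_red` — X_A3 on X10b: `hPT` gone;
* **`bsdpOnClassX10b_of_fine_red`** — the A5 class leaf with `hGr`, `hMT`, `hPT` GONE: remaining binders =
  Yan–Zhu 4.9 (flag `YZ26@3-BF-ERL-Ohta`), the two period-unit facts, Schneider 1985 (odd `p`),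
  Perrin-Riou (odd `p`), modularity package, GZK, F1, F2, the OPEN `AnalyticMuZeroOnClassX10b` (barrier
  B3) and the Schneider rider at rank `1`;
* `bsdpOnClassX10b_of_fine_red_of_mazur` — the same with the two period-unit facts (Greenberg–Vatsal 2000
  Remark 3.4, printed without proof) REPLACED by Mazur 1978 Cor. 4.1 in lattice form
  (`ModularForms.mazur_not_dvd_maninConstant_of_odd`, via `SkinnerUrban2014.realPeriodRat_eq_unit_mul_plusPeriod[_three]_of_mazur`).

References: K. Kato, Astérisque 295 (2004) Thm. 12.6 (p. 222), §13.8 (pp. 228–229), Lemma 8.5 (p. 183),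
(14.9.3), §17.13 [Kato2004Asterisque]; J. S. Milne, *Arithmetic Duality Theorems* (2006) I Thm. 4.10
[MilneADT2006]; R. Greenberg, LNM 1716 (1999) Thm. 4.1 [GreenbergLNM1716]; B. Mazur, J. Tate, Duke Math.
J. 62 (1991) Thm. 3.1 [MazurTate1991]; B. Mazur, W. Stein, J. Tate, Doc. Math. (2006) Thm. 1.3
[MazurSteinTate2006]; B. Mazur, Invent. Math. 44 (1978) Cor. 4.1 [Mazur1978]; R. Greenberg, V. Vatsal,
Invent. Math. 142 (2000) Prop. 3.7, Remark 3.4 [GreenbergVatsal2000].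
-/

set_option linter.dupNamespace false
set_option autoImplicit false

noncomputable section

open scoped Classical MatrixGroups ModularForm NumberField
open CongruenceSubgroup WeierstrassCurve Field IsDedekindDomain
open Literature.NumberTheory.GaloisRepresentations
open Literature.NumberTheory.GaloisCohomology
open Literature.NumberTheory.EllipticCurves Literature.NumberTheory.EllipticCurves.ModularForms
open Literature.NumberTheory.EllipticCurves.Kato2004
open Literature.NumberTheory.EllipticCurves.Kato2004.EulerSystemValues
open Literature.NumberTheory.EllipticCurves.Rank1Residual
open Summit.BirchSwinnertonDyer.BirchSwinnertonDyer.Theorems.Rank1ResidualX1Defs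
  Summit.BirchSwinnertonDyer.BirchSwinnertonDyer.Rank1Residual

namespace Summit.BirchSwinnertonDyer.Rank1Residual.X10

/-! ## The core: Kato §13.8 alone -/

/-- **N2's typed core from ONE published fact** (Kato §13.8, `Kato2004.mem_pSmul_of_red_eq_zero`): GEN 39's
`coreTheoremAOddPrime_of_facts` with Poitou–Tate over `ℚ` supplied by the tree theorem
`poitouTate_sum_localTatePairing_eq_zero_holds ℚ`.  Nothing asserted.
[cite: Kato2004Asterisque, §13.8 (pp. 228–229)] [cite: MilneADT2006, Ch. I, Thm. 4.10(b)] -/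
theorem coreTheoremAOddPrime_of_red (hred : mem_pSmul_of_red_eq_zero) : CoreTheoremAOddPrime :=
  coreTheoremAOddPrime_of_facts hred (poitouTate_sum_localTatePairing_eq_zero_holds ℚ)

/-- **N2's typed core from the WEAK Lemma 8.5 (2)** (F2 in k6-g4 g2's reduced form
`Kato2004.mem_pSmul_of_red_eq_zero_of_integral_of_smul_mem`: a norm-compatible family of classes of `T_pW`
along the cyclotomic layers whose `p`-multiples are integral is integral).  Nothing asserted.
[cite: Kato2004Asterisque, §13.8 (pp. 228–229) with Lemma 8.5 (2) (p. 183)] -/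
theorem coreTheoremAOddPrime_of_integral_of_smul_mem
    (hint : ∀ (W : WeierstrassCurve ℚ) [W.IsElliptic] (p : ℕ) [Fact p.Prime]
      [ContinuousSMul ℤ_[p] (W.tateModule p)] (κ : ZpExtension ℚ p), κ.IsCyclotomic →
      ∀ z : ∀ n : ℕ, H1 (tateRep W p) (κ.layerSubgroup n),
        (∀ n, layerCores (tateRep W p) κ n (z (n + 1)) = z n) →
        (∀ n, (p : ℤ_[p]) • z n ∈ integralH1 (tateRep W p) p (κ.layerSubgroup n)) →
          ∀ n, z n ∈ integralH1 (tateRep W p) p (κ.layerSubgroup n)) :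
    CoreTheoremAOddPrime :=
  coreTheoremAOddPrime_of_red (mem_pSmul_of_red_eq_zero_of_integral_of_smul_mem hint)

/-- **The registered `p = 3` shape `CoreTheoremAOnClassX10b` from Kato §13.8 alone** (GEN 36's node).
[cite: Kato2004Asterisque, §13.8 (pp. 228–229)] -/
theorem coreTheoremAOnClassX10b_of_red (hred : mem_pSmul_of_red_eq_zero) : CoreTheoremAOnClassX10b :=
  coreTheoremAOnClassX10b_of_oddPrime (coreTheoremAOddPrime_of_red hred)

/-! ## The `μ`-transfer: F1 ∧ F2 -/

/-- **`μ(X(E/ℚ_∞)) = 0` at every odd good ordinary prime with `E[p]` irreducible and `ρ̄` not surjective,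
given one unit coefficient of `L_p(f, α)` — from TWO published facts** (F1: Kato Thm. 12.6 with
(14.9.3)/§17.13, `exists_divisibilityInputs_fineQuotient_zeta`; F2: Kato §13.8); Poitou–Tate, Kato
(12.2.1) and the core are tree theorems.  Serves X9 at `p ∈ {5, 7}` AND X10b∧¬Surj at `p = 3`.
[cite: Kato2004Asterisque, Thm. 12.6 (p. 222), (14.9.3) (p. 240) and §17.13 (pp. 279–280)]
[cite: GreenbergVatsal2000, Prop. 3.7] -/
theorem mu_eq_zero_of_fine_red (hfine : exists_divisibilityInputs_fineQuotient_zeta)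
    (hred : mem_pSmul_of_red_eq_zero) :
    ∀ (W : WeierstrassCurve ℚ) [W.IsElliptic] [W.IsGloballyMinimal] (p : ℕ) [Fact p.Prime]
      {N : ℕ} [NeZero N] (f : CuspForm (Gamma0 N) 2),
      p ≠ 2 → W.HasGoodReductionAtPrime p → ¬ (p : ℤ) ∣ W.frobeniusTrace p →
      W.HasIrreducibleModPGaloisRep p → ¬ W.HasSurjectiveModNGaloisRep p → IsNewformOf W f →
      (∃ n : ℕ, ‖PowerSeries.coeff n (padicLFunction f (unitRoot W p : ℚ_[p]))‖ = 1) →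
      ∀ (κ : ZpExtension ℚ p) (γ : absoluteGaloisGroup ℚ),
        κ.IsCyclotomic → κ.IsTopGenerator γ → IsCyclotomicVariable p γ →
        ∀ D : W.SelmerDualData κ γ, D.mu = 0 :=
  mu_eq_zero_of_coreOddPrime nonempty_iwasawaH1Data_holds hfine (coreTheoremAOddPrime_of_red hred)

/-- **N2: the `μ`-transfer node `KatoMuTransferThree` (cell `bsd-smallim`, p407527) from F1 ∧ F2**
(Kato's Thm. 12.6 package with the fine quotient; Kato §13.8).
[cite: Kato2004Asterisque, Thm. 12.6 (p. 222), §13.8 (pp. 228–229) and §17.13 (pp. 279–280)]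
[cite: GreenbergVatsal2000, Prop. 3.7] -/
theorem katoMuTransferThree_of_fine_red (hfine : exists_divisibilityInputs_fineQuotient_zeta)
    (hred : mem_pSmul_of_red_eq_zero) : KatoMuTransferThree :=
  katoMuTransferThree_of_coreOddPrime nonempty_iwasawaH1Data_holds hfine (coreTheoremAOddPrime_of_red hred)

/-- **`KatoMuTransferThree` from F1 and the WEAK Lemma 8.5 (2)** (F2 in k6-g4 g2's reduced form).
[cite: Kato2004Asterisque, Thm. 12.6 (p. 222), §13.8 with Lemma 8.5 (2) (pp. 183, 228–229)] -/
theorem katoMuTransferThree_of_fine_of_integral (hfine : exists_divisibilityInputs_fineQuotient_zeta)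
    (hint : ∀ (W : WeierstrassCurve ℚ) [W.IsElliptic] (p : ℕ) [Fact p.Prime]
      [ContinuousSMul ℤ_[p] (W.tateModule p)] (κ : ZpExtension ℚ p), κ.IsCyclotomic →
      ∀ z : ∀ n : ℕ, H1 (tateRep W p) (κ.layerSubgroup n),
        (∀ n, layerCores (tateRep W p) κ n (z (n + 1)) = z n) →
        (∀ n, (p : ℤ_[p]) • z n ∈ integralH1 (tateRep W p) p (κ.layerSubgroup n)) →
          ∀ n, z n ∈ integralH1 (tateRep W p) p (κ.layerSubgroup n)) :
    KatoMuTransferThree :=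
  katoMuTransferThree_of_fine_red hfine (mem_pSmul_of_red_eq_zero_of_integral_of_smul_mem hint)

/-! ## The A5 chain: X_A3 on X10b and the class leaf, with every tree-provable binder supplied -/

/-- **X_A3 on class X10b with F3 discharged** (GEN 39's `mazurMainConjectureOnClassX10b_of_facts` minus
`hPT`; Yan–Zhu 4.9 `hYZ` flagged `YZ26@3-BF-ERL-Ohta` rides with the conclusion; `AnalyticMuZeroOnClassX10b`
= barrier B3; nothing booked). [cite: YanZhu2024MainConjNonCM, Thm. 4.9 (§4.4)]
[cite: Kato2004Asterisque, Thm. 12.6 (p. 222), §13.8 and §17.13 (pp. 279–280)] -/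
theorem mazurMainConjectureOnClassX10b_of_fine_red
    (hYZ : YanZhu2026.thm49_charIdeal_eq_padicLFunction)
    (h5 : realPeriodRat_eq_unit_mul_plusPeriod) (h3 : realPeriodRat_eq_unit_mul_plusPeriod_three)
    (hmodP : nonempty_modularParametrizationData)
    (hfine : exists_divisibilityInputs_fineQuotient_zeta) (hred : mem_pSmul_of_red_eq_zero)
    (hA : AnalyticMuZeroOnClassX10b) :
    MazurMainConjectureOnClassX10b :=
  mazurMainConjectureOnClassX10b_of_facts hYZ h5 h3 hmodP hfine hred
    (poitouTate_sum_localTatePairing_eq_zero_holds ℚ) hA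

/-- **The A5 class leaf `BSDpOnClassX10b` with Poitou–Tate over `ℚ`, the Mazur–Tate `σ`-existence at `3`
and Greenberg's Thm. 4.1 SUPPLIED BY TREE THEOREMS** (GEN 39's `bsdpOnClassX10b_of_facts` minus `hGr`,
`hMT`, `hPT`: `hPT := poitouTate_sum_localTatePairing_eq_zero_holds ℚ`, `hMT := mazur_tate_sigma_exists_odd_holds`,
`hGr := greenberg_charValue_rankZero_of_Schneider1985_odd hS hMT`).  Remaining binders: Yan–Zhu 4.9
(flagged), the two period-unit facts, Schneider 1985 / Perrin-Riou at odd `p`, the modular parametrisation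
package, GZK, F1, F2, the OPEN `AnalyticMuZeroOnClassX10b` (barrier B3) and the Schneider rider at rank `1`.
Nothing booked. [cite: YanZhu2024MainConjNonCM, Thm. 4.9 (§4.4)]
[cite: GreenbergLNM1716, Thm. 4.1 (p. 102) and §1 Conj. 1.11] [cite: MazurSteinTate2006, Thm. 1.3]
[cite: Kato2004Asterisque, Thm. 12.6 (p. 222), §13.8 and §17.13 (pp. 279–280)] [cite: Miller2011LMS, §1 and Def. 1.1] -/
theorem bsdpOnClassX10b_of_fine_red
    (hYZ : YanZhu2026.thm49_charIdeal_eq_padicLFunction)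
    (h5 : realPeriodRat_eq_unit_mul_plusPeriod) (h3 : realPeriodRat_eq_unit_mul_plusPeriod_three)
    (hS : Schneider1985_order_charGenerator_odd) (hPR : perrinRiou_rankOne_leadingTerms_odd)
    (hmodP : nonempty_modularParametrizationData)
    (hGZK : rank_eq_analyticRank_of_analyticRank_le_one)
    (hfine : exists_divisibilityInputs_fineQuotient_zeta) (hred : mem_pSmul_of_red_eq_zero)
    (hA : AnalyticMuZeroOnClassX10b)
    (hC3 : ∀ (W : WeierstrassCurve ℚ) [W.IsElliptic] [W.IsGloballyMinimal] (p : ℕ) [Fact p.Prime],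
      ClassX10 W p → ¬ Surj W 3 → W.analyticRank = 1 →
        ∀ Dh : PAdicHeightData W p, Dh.IsCanonical → SchneiderConjecture Dh) :
    BSDpOnClassX10b :=
  bsdpOnClassX10b_of_facts hYZ
    (greenberg_charValue_rankZero_of_Schneider1985_odd hS mazur_tate_sigma_exists_odd_holds) h5 h3 hS hPR
    mazur_tate_sigma_exists_odd_holds hmodP hGZK hfine hred
    (poitouTate_sum_localTatePairing_eq_zero_holds ℚ) hA hC3

/-- **The A5 class leaf with the period-unit binders sourced to Mazur 1978, Cor. 4.1** — the same as
`bsdpOnClassX10b_of_fine_red` with the two facts `realPeriodRat_eq_unit_mul_plusPeriod[_three]`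
(Greenberg–Vatsal 2000 §3 Remark 3.4, printed without proof) REPLACED by the single lattice-form fact
`ModularForms.mazur_not_dvd_maninConstant_of_odd` (Mazur 1978 Cor. 4.1: `p ∤ c` for odd `p` with
`p² ∤ N`), through `SkinnerUrban2014.realPeriodRat_eq_unit_mul_plusPeriod[_three]_of_mazur`.  Nothing
booked. [cite: Mazur1978, Cor. 4.1] [cite: GreenbergVatsal2000, §3, Remark 3.4]
[cite: YanZhu2024MainConjNonCM, Thm. 4.9 (§4.4)] [cite: GreenbergLNM1716, Thm. 4.1 (p. 102)] -/
theorem bsdpOnClassX10b_of_fine_red_of_mazur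
    (hYZ : YanZhu2026.thm49_charIdeal_eq_padicLFunction)
    (hM : mazur_not_dvd_maninConstant_of_odd)
    (hS : Schneider1985_order_charGenerator_odd) (hPR : perrinRiou_rankOne_leadingTerms_odd)
    (hmodP : nonempty_modularParametrizationData)
    (hGZK : rank_eq_analyticRank_of_analyticRank_le_one)
    (hfine : exists_divisibilityInputs_fineQuotient_zeta) (hred : mem_pSmul_of_red_eq_zero)
    (hA : AnalyticMuZeroOnClassX10b)
    (hC3 : ∀ (W : WeierstrassCurve ℚ) [W.IsElliptic] [W.IsGloballyMinimal] (p : ℕ) [Fact p.Prime],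
      ClassX10 W p → ¬ Surj W 3 → W.analyticRank = 1 →
        ∀ Dh : PAdicHeightData W p, Dh.IsCanonical → SchneiderConjecture Dh) :
    BSDpOnClassX10b :=
  bsdpOnClassX10b_of_fine_red hYZ (SkinnerUrban2014.realPeriodRat_eq_unit_mul_plusPeriod_of_mazur hM)
    (SkinnerUrban2014.realPeriodRat_eq_unit_mul_plusPeriod_three_of_mazur hM) hS hPR hmodP hGZK hfine hred
    hA hC3

end Summit.BirchSwinnertonDyer.Rank1Residual.X10

end
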